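import Literature.NumberTheory.Automorphic.ArchRankOneOrbitalVolumeWallBound       -- ★ p850846 (this seat): brings ★ (α2) `…cayley_comp_clm_le` (p850774), `U(Φ₂)_w ↪ M₂(ℂ)` closed, `isCompact_setOf_exists_conj_endoBlock_mem_of_not_mem`
import Literature.Analysis.Calculus.ContDiffCurryCompact                         -- ★ (CURRY-∞) p850802 (F0P3a-p02 (g20)): `contDiff_curry_of_contDiff`, `hasCompactSupport_curry_of_forall_apply_eq`
import Mathlib.MeasureTheory.Integral.BoundedContinuousFunction                  -- `BoundedContinuousFunction.integrable`, `norm_integral_le_mul_norm`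
import HarnessLib

/-!
# The one-place Casimir engine WITH COMPACT PARAMETERS AND AVERAGING: bounded `ψ`-jets of `ψ ↦ ∫_P 2 sin ψ · ∫_{U(Φ₂)_w} Φ(ι p, ↑↑(h · P t_z(ψ) P⁻¹ · h⁻¹)) dν(h) dρ(p)`,
# uniformly over the finite measures `ρ` on the parameter space (stage (α4-S3) of the transport of ★ (ELL-∞) to Bouaziz (I₂); Varadarajan 1989 §6.4 Thm 22, Bouaziz 1994 §3.1)

Topic `NumberTheory/Automorphic`; namespace `Literature.NumberTheory.Automorphic.UnitaryGroup`.  THEOREMS ONLY (no `def`, no instance, no axiom, no `sorry`).  Cell `pub/hodgecm-mathlib`,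
crux H413 (`stmt-HodgeConjecture-24833`), line LH3 (closer stub `stub_N9`, DIRECT ROAD), organ O-L3′ conjunct (ii) pay-down for GENERAL `fH` (LH3-plan (g3) RULINGS #7 (d) ∕ #11), stage
(α4-S3).  Author LH3-p01 (g4).  Count-neutral.

THE POINT.  After ★ (α4¹) `exists_placeLeaves_archRH_mul_chartOrbH_eq_integral_integral` (a wall place `w₀` integrated out first) the model of the normalised stable orbital family near a
wall point reads `ψ ↦ ∫_{p ∈ P} 2 sin ψ · ∫_{U(Φ₂)_{w₀}} Φ(ι p, ↑↑(h · P t_z(ψ) P⁻¹ · h⁻¹)) dν(h) dρ(p)` with `P` a COMPACT space of parameters (the other leaves' variables on the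
compact set where the integrand lives, the other coordinates), `ι : P → Q` continuous into a normed space, `Φ : Q × M₂(ℂ) → E` jointly `C^∞` (the ambient lift of `fH`), `Φ(ι p, ·)`
supported in one compact `K`, and `ρ` a finite measure on `P` (the outer leaf measure restricted to that compact).  ★ (CURRY-∞) `contDiff_curry_of_contDiff` turns the family into ONE smooth
compactly supported `g : M₂(ℂ) → (P →ᵇ E)`, the `ρ`-average is a continuous linear functional `ℓ_ρ` on `P →ᵇ E` of norm `≤ ρ(P)` (**`exists_integral_clm_boundedContinuousFunction`**),
and by linearity of the Bochner integral (Mathlib `ContinuousLinearMap.integral_comp_comm`, no Fubini, no differentiation under the integral sign)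
  `2 sin ψ · ∫_h ℓ_ρ(g(↑↑(h t h⁻¹))) dν = ∫_P 2 sin ψ · ∫_h Φ(ι p, ↑↑(h t h⁻¹)) dν dρ`  (**`two_sin_smul_integral_clm_comp_eq_integral`**),
so ★ (α2) `exists_forall_eventually_norm_iteratedDeriv_orbitalIntegral_cayley_comp_clm_le` (`‖(F(ℓ ∘ g))⁽ⁿ⁾(ψ)‖ ≤ ‖ℓ‖ · B` for ALL `ℓ`) gives the HEAD
**`exists_forall_eventually_norm_iteratedDeriv_average_orbitalIntegral_cayley_le`**: `∃ B ≥ 0, ∀ᶠ ψ in 𝓝[≠] 0, ∀ ρ finite, ‖∂_ψⁿ [∫_P 2 sin ψ ∫_h Φ(ι p, ↑↑(h · P t_z(ψ) P⁻¹ · h⁻¹)) dν dρ]‖ ≤ ρ(P) · B`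
— the bound is uniform in the parameters AND in the averaging measure (the punctured neighbourhood does not depend on `ρ`).
HONEST LABEL: HC_CM is proved only modulo the 7 printed citations (2 remaining: hLiu418 = stmt-HodgeConjecture-24832, h413 = stmt-HodgeConjecture-24833) until rung 0 closes; one
stage of the all-orders transport, pays nothing by itself (the ambient lift `Φ` of `fH` at a wall place, (α4-S2), and the assembly are separate).

## References
* [Varadarajan1989] V. S. Varadarajan, *An Introduction to Harmonic Analysis on Semisimple Lie Groups*, Cambridge Stud. Adv. Math. 16 (1989), §6.4 Thms 22–24.
* [Bouaziz1994IntegralesOrbitales] A. Bouaziz, *Intégrales orbitales sur les algèbres de Lie réductives*, Invent. Math. 115 (1994), §3.1 (I₂) p. 579.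
* [HormanderALPDO1] L. Hörmander, *The Analysis of Linear Partial Differential Operators I* (1990), §1.1 Thms. 1.1.6–1.1.9.
* [Rogawski1990] J. D. Rogawski, *Automorphic Representations of Unitary Groups in Three Variables*, Ann. of Math. Stud. 123 (1990), §8.2 pp. 119–122.
-/

set_option autoImplicit false

noncomputable section

open MeasureTheory Measure Filter Topology Set Function NumberField NumberField.InfinitePlace Matrix Complex BoundedContinuousFunction
open Literature.NumberTheory.Automorphic Literature.NumberTheory.Automorphic.ArchCartan
open scoped ContDiff MatrixGroups Matrix ENNReal NNReal
open scoped Matrix.Norms.Operator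

namespace Literature.NumberTheory.Automorphic.UnitaryGroup

local notation3 "Φ₂[" L "]" => (Matrix.of fun i j : Fin 2 => if i.val + j.val + 1 = 2 then (1 : L) else 0)

/-! ## §1 Averaging over a finite measure is a continuous linear functional on `P →ᵇ E` -/

section Average

variable {P : Type*} [TopologicalSpace P] [MeasurableSpace P] [OpensMeasurableSpace P]
  {E : Type*} [NormedAddCommGroup E] [NormedSpace ℝ E] [SecondCountableTopology E] [MeasurableSpace E] [BorelSpace E] [CompleteSpace E]

omit [CompleteSpace E] in
/-- **The `ρ`-average `φ ↦ ∫_P φ dρ` is a continuous linear functional on `P →ᵇ E` of norm `≤ ρ(P)`** (Mathlib `BoundedContinuousFunction.norm_integral_le_mul_norm`).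
[cite: HormanderALPDO1, §1.1 Thm. 1.1.6] -/
theorem exists_integral_clm_boundedContinuousFunction (ρ : Measure P) [IsFiniteMeasure ρ] :
    ∃ ℓ : (P →ᵇ E) →L[ℝ] E, (∀ φ : P →ᵇ E, ℓ φ = ∫ p, φ p ∂ρ) ∧ ‖ℓ‖ ≤ ρ.real univ := by
  let Λ : (P →ᵇ E) →ₗ[ℝ] E :=
    { toFun := fun φ => ∫ p, φ p ∂ρ
      map_add' := fun φ₁ φ₂ => by
        show ∫ p, (φ₁ + φ₂) p ∂ρ = ∫ p, φ₁ p ∂ρ + ∫ p, φ₂ p ∂ρ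
        simp only [BoundedContinuousFunction.coe_add, Pi.add_apply]
        exact integral_add (φ₁.integrable ρ) (φ₂.integrable ρ)
      map_smul' := fun a φ => by
        show ∫ p, (a • φ) p ∂ρ = a • ∫ p, φ p ∂ρ
        simp only [BoundedContinuousFunction.coe_smul]
        exact integral_smul a _ }
  refine ⟨Λ.mkContinuous (ρ.real univ) fun φ => φ.norm_integral_le_mul_norm ρ, fun φ => rfl, ?_⟩
  exact Λ.mkContinuous_norm_le measureReal_nonneg _

end Average

/-! ## §2 The averaged functional IS the engine's functional for the test function `ℓ_ρ ∘ g` -/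

section Identity

variable (L : Type) [Field L] [NumberField L] (w : {w : InfinitePlace L // IsComplex w})
  [MeasurableSpace ↥(archLocal L 2 Φ₂[L] w)] [BorelSpace ↥(archLocal L 2 Φ₂[L] w)]
  (ν : Measure ↥(archLocal L 2 Φ₂[L] w)) [IsFiniteMeasureOnCompacts ν]
  {P : Type*} [TopologicalSpace P] [MeasurableSpace P] [OpensMeasurableSpace P]
  {E : Type*} [NormedAddCommGroup E] [NormedSpace ℝ E] [SecondCountableTopology E] [MeasurableSpace E] [BorelSpace E] [CompleteSpace E]

omit [OpensMeasurableSpace P] [SecondCountableTopology E] [MeasurableSpace E] [BorelSpace E] in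
/-- **`2 sin ψ · ∫_h ℓ_ρ(g(↑↑(h · P t_z(ψ) P⁻¹ · h⁻¹))) dν = ∫_P 2 sin ψ · ∫_h g(↑↑(h · P t_z(ψ) P⁻¹ · h⁻¹))(p) dν dρ(p)`** for a continuous compactly supported `g : M₂(ℂ) → (P →ᵇ E)` and
the averaging functional `ℓ_ρ` of a finite measure `ρ`: for `sin ψ ≠ 0` the torus point is regular, the integrand `h ↦ g(↑↑(h t h⁻¹))` is continuous with compact support (the
conjugating set of a compact is compact, ★ `isCompact_setOf_exists_conj_endoBlock_mem_of_not_mem`; `U(Φ₂)_w ↪ M₂(ℂ)` is closed), and continuous linear maps commute with its Bochner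
integral (`ℓ_ρ`, then the evaluations); for `sin ψ = 0` both sides vanish. [cite: HormanderALPDO1, §1.1 Thm. 1.1.6] [cite: Rogawski1990, §8.2 p. 122] -/
theorem two_sin_smul_integral_clm_comp_eq_integral (g : Matrix (Fin 2) (Fin 2) ℂ → (P →ᵇ E)) (hg : Continuous g) (hgc : HasCompactSupport g)
    (ρ : Measure P) [IsFiniteMeasure ρ] (ℓ : (P →ᵇ E) →L[ℝ] E) (hℓ : ∀ φ : P →ᵇ E, ℓ φ = ∫ p, φ p ∂ρ) (z : Circle) (ψ : ℝ) :
    (2 * Real.sin ψ) • ∫ h : ↥(archLocal L 2 Φ₂[L] w), ℓ (g (((h * ⟨Matrix.GeneralLinearGroup.mkOfDetNeZero !![(1 : ℂ), 1; 1, -1] det_cayleyTwo_ne_zero *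
        circleDiagonal 2 ![z * Circle.exp ψ, z * Circle.exp (-ψ)] * (Matrix.GeneralLinearGroup.mkOfDetNeZero !![(1 : ℂ), 1; 1, -1] det_cayleyTwo_ne_zero)⁻¹,
        cayley_conj_circleDiagonal_mem_archLocal L w _⟩ * h⁻¹ : ↥(archLocal L 2 Φ₂[L] w)) : GL (Fin 2) ℂ) : Matrix (Fin 2) (Fin 2) ℂ)) ∂ν =
      ∫ p, (2 * Real.sin ψ) • (∫ h : ↥(archLocal L 2 Φ₂[L] w), g (((h * ⟨Matrix.GeneralLinearGroup.mkOfDetNeZero !![(1 : ℂ), 1; 1, -1] det_cayleyTwo_ne_zero *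
        circleDiagonal 2 ![z * Circle.exp ψ, z * Circle.exp (-ψ)] * (Matrix.GeneralLinearGroup.mkOfDetNeZero !![(1 : ℂ), 1; 1, -1] det_cayleyTwo_ne_zero)⁻¹,
        cayley_conj_circleDiagonal_mem_archLocal L w _⟩ * h⁻¹ : ↥(archLocal L 2 Φ₂[L] w)) : GL (Fin 2) ℂ) : Matrix (Fin 2) (Fin 2) ℂ) p ∂ν) ∂ρ := by
  haveI : LocallyCompactSpace ↥(archLocal L 2 Φ₂[L] w) := locallyCompactSpace_archLocal L 2 Φ₂[L] w
  haveI : SecondCountableTopology ↥(archLocal L 2 Φ₂[L] w) := secondCountableTopology_archLocal L 2 Φ₂[L] w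
  -- notation: the torus point
  set T : ↥(archLocal L 2 Φ₂[L] w) := ⟨Matrix.GeneralLinearGroup.mkOfDetNeZero !![(1 : ℂ), 1; 1, -1] det_cayleyTwo_ne_zero *
        circleDiagonal 2 ![z * Circle.exp ψ, z * Circle.exp (-ψ)] * (Matrix.GeneralLinearGroup.mkOfDetNeZero !![(1 : ℂ), 1; 1, -1] det_cayleyTwo_ne_zero)⁻¹,
        cayley_conj_circleDiagonal_mem_archLocal L w _⟩ with hT_def
  by_cases hsin : Real.sin ψ = 0
  · simp only [hsin, mul_zero, zero_smul, integral_zero]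
  -- the torus point is a REGULAR compact chart point: `T = endoBlock L ∅ c w`, `c w = (θ + ψ, 0, θ − ψ)`, `z = e^{iθ}`
  obtain ⟨θ, hθ⟩ := Circle.exp_surjective z  -- hmm: name? provides θ with Circle.exp θ = z
  have hT : T = endoBlock L ∅ (fun _ => ![θ + ψ, 0, θ - ψ]) w := by
    rw [hT_def]
    have h1 : z * Circle.exp ψ = Circle.exp (θ + ψ) := by rw [← hθ, Circle.exp_add]
    have h2 : z * Circle.exp (-ψ) = Circle.exp (θ - ψ) := by rw [← hθ, sub_eq_add_neg, Circle.exp_add]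
    rw [h1, h2]
    unfold endoBlock
    rw [if_neg (Finset.notMem_empty w)]
    simp only [Matrix.cons_val_zero, Matrix.cons_val_two, Matrix.tail_cons, Matrix.head_cons]
  have hreg : ∀ c ∈ ({fun _ => ![θ + ψ, 0, θ - ψ]} : Set ({w : InfinitePlace L // IsComplex w} → Fin 3 → ℝ)), Circle.exp (c w 0) ≠ Circle.exp (c w 2) := by
    intro c hc h
    rw [mem_singleton_iff.1 hc] at h
    simp only [Matrix.cons_val_zero, Matrix.cons_val_two, Matrix.tail_cons, Matrix.head_cons] at h
    obtain ⟨m, hm⟩ := Circle.exp_eq_exp.1 h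
    apply hsin
    rw [show ψ = (m : ℝ) * Real.pi by linarith]
    exact Real.sin_int_mul_pi m
  -- the integrand is continuous with compact support, hence integrable
  have hce : IsClosedEmbedding (fun g : ↥(archLocal L 2 Φ₂[L] w) => ((g : GL (Fin 2) ℂ) : Matrix (Fin 2) (Fin 2) ℂ)) :=
    isClosedEmbedding_coe_unitaryGroupOfForm_of_eq_over (by rw [Literature.NumberTheory.Rogawski1990.antidiagOne_map, StdForm.over_antidiagonal_eq])
  have hconj_c : Continuous fun h : ↥(archLocal L 2 Φ₂[L] w) => (((h * T * h⁻¹ : ↥(archLocal L 2 Φ₂[L] w)) : GL (Fin 2) ℂ) : Matrix (Fin 2) (Fin 2) ℂ) :=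
    hce.continuous.comp ((continuous_id.mul continuous_const).mul continuous_id.inv)
  have hKC : IsCompact {y : ↥(archLocal L 2 Φ₂[L] w) | ∃ c ∈ ({fun _ => ![θ + ψ, 0, θ - ψ]} : Set ({w : InfinitePlace L // IsComplex w} → Fin 3 → ℝ)),
      y * endoBlock L ∅ c w * y⁻¹ ∈ (fun g : ↥(archLocal L 2 Φ₂[L] w) => ((g : GL (Fin 2) ℂ) : Matrix (Fin 2) (Fin 2) ℂ)) ⁻¹' tsupport g} :=
    isCompact_setOf_exists_conj_endoBlock_mem_of_not_mem L w ∅ (Finset.notMem_empty w) isCompact_singleton hreg (hce.isCompact_preimage hgc)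
  have hint : Integrable (fun h : ↥(archLocal L 2 Φ₂[L] w) => g (((h * T * h⁻¹ : ↥(archLocal L 2 Φ₂[L] w)) : GL (Fin 2) ℂ) : Matrix (Fin 2) (Fin 2) ℂ)) ν := by
    refine (hg.comp hconj_c).integrable_of_hasCompactSupport (HasCompactSupport.intro hKC fun h hh => ?_)
    have hh' : ¬ (((h * T * h⁻¹ : ↥(archLocal L 2 Φ₂[L] w)) : GL (Fin 2) ℂ) : Matrix (Fin 2) (Fin 2) ℂ) ∈ tsupport g := by
      intro h'
      exact hh ⟨fun _ => ![θ + ψ, 0, θ - ψ], mem_singleton _, by rw [← hT]; exact h'⟩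
    exact image_eq_zero_of_notMem_tsupport (f := g) hh'
  -- continuous linear maps commute with the Bochner integral: `ℓ_ρ`, then the evaluations
  rw [ℓ.integral_comp_comm hint, hℓ, ← integral_smul]
  refine integral_congr_ae (Eventually.of_forall fun p => ?_)
  show (2 * Real.sin ψ) • (∫ h, g (((h * T * h⁻¹ : ↥(archLocal L 2 Φ₂[L] w)) : GL (Fin 2) ℂ) : Matrix (Fin 2) (Fin 2) ℂ) ∂ν) p =
    (2 * Real.sin ψ) • (∫ h, g (((h * T * h⁻¹ : ↥(archLocal L 2 Φ₂[L] w)) : GL (Fin 2) ℂ) : Matrix (Fin 2) (Fin 2) ℂ) p ∂ν)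
  congr 1
  exact ((BoundedContinuousFunction.evalCLM ℝ p).integral_comp_comm hint).symm

end Identity

/-! ## §3 THE HEAD: bounded `ψ`-jets of the averaged normalised orbital integral of a jointly smooth compactly supported family, uniformly in the averaging measure -/

section Head

variable (L : Type) [Field L] [NumberField L] (w : {w : InfinitePlace L // IsComplex w})
  [MeasurableSpace ↥(archLocal L 2 Φ₂[L] w)] [BorelSpace ↥(archLocal L 2 Φ₂[L] w)]
  (ν : Measure ↥(archLocal L 2 Φ₂[L] w)) [ν.IsHaarMeasure] [ν.IsMulRightInvariant]
  {P : Type*} [TopologicalSpace P] [CompactSpace P] [MeasurableSpace P] [OpensMeasurableSpace P]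
  {Q : Type*} [NormedAddCommGroup Q] [NormedSpace ℝ Q]
  {E : Type*} [NormedAddCommGroup E] [NormedSpace ℝ E] [SecondCountableTopology E] [MeasurableSpace E] [BorelSpace E] [CompleteSpace E]

/-- **THE ONE-PLACE ENGINE WITH COMPACT PARAMETERS AND AVERAGING.**  For a Haar measure `ν` on `U(Φ₂)_w`, a compact parameter space `P`, `ι : P → Q` continuous into a normed space,
`Φ : Q × M₂(ℂ) → E` jointly `C^∞` with `Φ(ι p, ·)` supported in a fixed compact `K` for all `p`, a centre `z ∈ S¹` and an order `n`, there is `B ≥ 0` with, on a punctured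
neighbourhood of `ψ = 0` INDEPENDENT OF `ρ`, for EVERY finite measure `ρ` on `P`:
`‖∂_ψⁿ [ψ ↦ ∫_P 2 sin ψ · ∫_{U(Φ₂)_w} Φ(ι p, ↑↑(h · P t_z(ψ) P⁻¹ · h⁻¹)) dν(h) dρ(p)] (ψ)‖ ≤ ρ(P) · B` — ★ (α2) `…cayley_comp_clm_le` for the curried test function
`g : M₂(ℂ) → (P →ᵇ E)` (★ (CURRY-∞)) and the averaging functionals `ℓ_ρ` (§1–§2). [cite: Varadarajan1989, §6.4 Thm 22] [cite: Bouaziz1994IntegralesOrbitales, §3.1 (I₂) p. 579]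
[cite: HormanderALPDO1, §1.1 Thms. 1.1.6–1.1.9] -/
theorem exists_forall_eventually_norm_iteratedDeriv_average_orbitalIntegral_cayley_le (Φ : Q × Matrix (Fin 2) (Fin 2) ℂ → E) (hΦ : ContDiff ℝ ∞ Φ)
    (ι : P → Q) (hι : Continuous ι) {K : Set (Matrix (Fin 2) (Fin 2) ℂ)} (hK : IsCompact K) (h0 : ∀ p, ∀ Y ∉ K, Φ (ι p, Y) = 0) (z : Circle) (n : ℕ) :
    ∃ B : ℝ, 0 ≤ B ∧ ∀ᶠ ψ in 𝓝[≠] (0 : ℝ), ∀ ρ : Measure P, IsFiniteMeasure ρ →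
      ‖iteratedDeriv n (fun ψ => ∫ p, (2 * Real.sin ψ) • (∫ h : ↥(archLocal L 2 Φ₂[L] w),
          Φ (ι p, (((h * ⟨Matrix.GeneralLinearGroup.mkOfDetNeZero !![(1 : ℂ), 1; 1, -1] det_cayleyTwo_ne_zero *
            circleDiagonal 2 ![z * Circle.exp ψ, z * Circle.exp (-ψ)] * (Matrix.GeneralLinearGroup.mkOfDetNeZero !![(1 : ℂ), 1; 1, -1] det_cayleyTwo_ne_zero)⁻¹,
            cayley_conj_circleDiagonal_mem_archLocal L w _⟩ * h⁻¹ : ↥(archLocal L 2 Φ₂[L] w)) : GL (Fin 2) ℂ) : Matrix (Fin 2) (Fin 2) ℂ)) ∂ν) ∂ρ) ψ‖ ≤ ρ.real univ * B := by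
  -- the curried test function `g : M₂(ℂ) → (P →ᵇ E)`
  have hΦc : Continuous fun q : P × Matrix (Fin 2) (Fin 2) ℂ => Φ (ι q.1, q.2) := hΦ.continuous.comp ((hι.comp continuous_fst).prodMk continuous_snd)
  let g : Matrix (Fin 2) (Fin 2) ℂ → (P →ᵇ E) := fun Y =>
    BoundedContinuousFunction.mkOfCompact ⟨fun p => Φ (ι p, Y), hΦc.comp (continuous_id.prodMk continuous_const)⟩
  have hg : ∀ Y p, g Y p = Φ (ι p, Y) := fun _ _ => rfl
  have hgs : ContDiff ℝ ∞ g := Literature.Analysis.Calculus.contDiff_curry_of_contDiff hΦ hι hg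
  have hgc : HasCompactSupport g := Literature.Analysis.Calculus.hasCompactSupport_curry_of_forall_apply_eq (f := fun q : P × Matrix (Fin 2) (Fin 2) ℂ => Φ (ι q.1, q.2)) hg hK h0
  -- the engine for `E' = P →ᵇ E`
  obtain ⟨B, hB0, hB⟩ := exists_forall_eventually_norm_iteratedDeriv_orbitalIntegral_cayley_comp_clm_le (E := E) L w ν
    (fun f ψ => (2 * Real.sin ψ) • ∫ h : ↥(archLocal L 2 Φ₂[L] w),
      f (((h * ⟨Matrix.GeneralLinearGroup.mkOfDetNeZero !![(1 : ℂ), 1; 1, -1] det_cayleyTwo_ne_zero *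
        circleDiagonal 2 ![z * Circle.exp ψ, z * Circle.exp (-ψ)] * (Matrix.GeneralLinearGroup.mkOfDetNeZero !![(1 : ℂ), 1; 1, -1] det_cayleyTwo_ne_zero)⁻¹,
        cayley_conj_circleDiagonal_mem_archLocal L w _⟩ * h⁻¹ : ↥(archLocal L 2 Φ₂[L] w)) : GL (Fin 2) ℂ) : Matrix (Fin 2) (Fin 2) ℂ) ∂ν)
    z (fun _ _ => rfl) hgs hgc n
  refine ⟨B, hB0, hB.mono fun ψ hψ ρ hρ => ?_⟩
  haveI := hρ
  obtain ⟨ℓ, hℓ, hℓn⟩ := exists_integral_clm_boundedContinuousFunction (E := E) ρ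
  -- the averaged functional IS the engine's functional for `ℓ_ρ ∘ g` (§2), as functions of `ψ`
  have hfun : (fun ψ => ∫ p, (2 * Real.sin ψ) • (∫ h : ↥(archLocal L 2 Φ₂[L] w),
      Φ (ι p, (((h * ⟨Matrix.GeneralLinearGroup.mkOfDetNeZero !![(1 : ℂ), 1; 1, -1] det_cayleyTwo_ne_zero *
        circleDiagonal 2 ![z * Circle.exp ψ, z * Circle.exp (-ψ)] * (Matrix.GeneralLinearGroup.mkOfDetNeZero !![(1 : ℂ), 1; 1, -1] det_cayleyTwo_ne_zero)⁻¹,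
        cayley_conj_circleDiagonal_mem_archLocal L w _⟩ * h⁻¹ : ↥(archLocal L 2 Φ₂[L] w)) : GL (Fin 2) ℂ) : Matrix (Fin 2) (Fin 2) ℂ)) ∂ν) ∂ρ) =
      fun ψ => (2 * Real.sin ψ) • ∫ h : ↥(archLocal L 2 Φ₂[L] w),
        (fun X => ℓ (g X)) (((h * ⟨Matrix.GeneralLinearGroup.mkOfDetNeZero !![(1 : ℂ), 1; 1, -1] det_cayleyTwo_ne_zero *
          circleDiagonal 2 ![z * Circle.exp ψ, z * Circle.exp (-ψ)] * (Matrix.GeneralLinearGroup.mkOfDetNeZero !![(1 : ℂ), 1; 1, -1] det_cayleyTwo_ne_zero)⁻¹,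
          cayley_conj_circleDiagonal_mem_archLocal L w _⟩ * h⁻¹ : ↥(archLocal L 2 Φ₂[L] w)) : GL (Fin 2) ℂ) : Matrix (Fin 2) (Fin 2) ℂ) ∂ν := by
    funext ψ
    exact (two_sin_smul_integral_clm_comp_eq_integral L w ν g hgs.continuous hgc ρ ℓ hℓ z ψ).symm
  rw [hfun]
  exact (hψ ℓ).trans (mul_le_mul_of_nonneg_right hℓn hB0)

end Head

end Literature.NumberTheory.Automorphic.UnitaryGroup

end
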